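import Literature.Analysis.FluidPDE.LinearisedNSFourierEstimates
import HarnessLib

/-!
# Picard iteration for the Fourier-transformed linearised Navier–Stokes equation: the Duhamel map

Analysis/FluidPDE proof file, third of the files `LinearisedNSFourier*` (objects in
`LinearisedNSFourierDefs`, symbol estimates in `LinearisedNSFourierEstimates`) proving existence
of smooth solutions of the linearised Navier–Stokes system along a smooth divergence-free field
on `[0, T] × T^d` (Constantin–Foias 1988, Ch. 14, (14.3)). For Fourier-side data `(ν, T, U, a)`
under `PicardHyp` (viscosity `ν > 0`, drift coefficients `Uⱼ(t)`, datum `a`, every polynomial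
decay, continuity in time) the mild (Duhamel) form of `∂ₜcₗ = -νₖ cₗ - (P linSym)(U, c)ₗ`,
`νₖ = 4π²ν|k|²`, is the fixed-point equation

  `c(l,t,k) = e^{-νₖτ} a(l,k) - ∫₀^τ e^{-νₖ(τ-s)} (P linSym)(U(s), c(s))(l,k) ds`, `τ = clamp T t`,

and this file provides the two ingredients of the contraction argument, the vector /
Leray-projected twin of `ScalarFourierPicard` (§§ Duhamel, Contraction) at a general viscosity:

* `PicardHyp.continuous_picardMap` — continuity in time of `Φ(c)` for `c` continuous with
  uniform decay of the base order `2#d + 1`; the first iterate `Φ(0) = e^{-νₖτ} a`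
  (`picardMap_zero_field`, `PicardHyp.hasDecay_picardMap_zero`);
* `PicardHyp.hasDecay_picardMap_sub` — the **Lipschitz estimate in the weighted sup-norm**
  `sup e^{-λ clamp t}(1+‖k‖)^{K+1}‖·‖`: the map is affine in `c`, the projected symbol loses one
  derivative (`hasDecay_linSym`, `hasDecay_linProjSym`) and the heat factor regains it at the
  price `λ^{-1/2}` (`ScalarFourier.heat_weight_gain`:
  `(1+‖k‖)∫₀^τ e^{-νₖ(τ-s)}e^{λs} ds ≤ e^{λτ}(1 + 1/(2√(4π²ν)))/√λ`);
* `PicardHyp.exists_contraction` — for every order `K ≥ 2#d` a weight `λ_K ≥ 1` with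
  contraction factor `1/2` on the WHOLE interval (the equation is linear; Lemarié-Rieusset 2016,
  §8.5, for the weighted-`L^∞` method).

The iteration itself (convergence, the limit, the fixed point, the datum) is in
`LinearisedNSFourierIteration`.

## References

* P. Constantin, C. Foias, *Navier–Stokes Equations*, Univ. Chicago Press 1988, Ch. 14, (14.3). [`ConstantinFoiasNSE1988`]
* P. G. Lemarié-Rieusset, *The Navier–Stokes problem in the 21st century*, CRC 2016, §8.5.
* J. Leray, Acta Math. 63 (1934), §19 (successive approximations). [`Leray1934`]
-/

noncomputable section

open MeasureTheory Real Set Filter Topology UnitAddTorus intervalIntegral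

namespace Literature.Analysis.FluidPDE

namespace LinearisedNSFourier

open ScalarFourier
open CorrectorFourier (leraySym)
open FourierNS (HasDecay clamp)
open Literature.Analysis.FunctionSpaces.Torus (freqNormSq)

variable {d : Type*} [Fintype d] [DecidableEq d]
variable {ν T : ℝ} {U : d → ℝ → (d → ℤ) → ℂ} {a : d → (d → ℤ) → ℂ}

/-! ### Nonnegative constants of the data -/

section Constants

omit [DecidableEq d] in
/-- Nonnegative uniform decay constants of the drift coefficients. [folklore] -/
theorem PicardHyp.decayU_nonneg (h : PicardHyp ν T U a) (K : ℕ) :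
    ∃ A : ℝ, 0 ≤ A ∧ ∀ j t, HasDecay K A (U j t) := by
  obtain ⟨A, hA⟩ := h.decayU K
  exact ⟨max A 0, le_max_right _ _, fun j t => (hA j t).mono (le_max_left _ _)⟩

omit [DecidableEq d] in
/-- Nonnegative decay constants of the datum. [folklore] -/
theorem PicardHyp.decayA_nonneg (h : PicardHyp ν T U a) (K : ℕ) :
    ∃ A₀ : ℝ, 0 ≤ A₀ ∧ ∀ l, HasDecay K A₀ (a l) := by
  obtain ⟨A₀, hA₀⟩ := h.decayA K
  exact ⟨max A₀ 0, le_max_right _ _, fun l => (hA₀ l).mono (le_max_left _ _)⟩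

end Constants

/-! ### The Duhamel map: continuity and the first iterate -/

section Duhamel

/-- The projected symbol of a continuous, uniformly decaying velocity coefficient field along
the drift data is continuous in time at each component and frequency. [folklore] -/
theorem PicardHyp.continuous_linProjSym (h : PicardHyp ν T U a) {c : d → ℝ → (d → ℤ) → ℂ}
    {X : ℝ} (hc : ∀ l m, Continuous fun t => c l t m) (hcd : ∀ l t, HasDecay (latOrder d + 1) X (c l t))
    (l : d) (k : d → ℤ) : Continuous fun s => linProjSym (fun j => U j s) (fun j => c j s) l k := by
  obtain ⟨A, hA⟩ := h.decayU (latOrder d + 1)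
  exact continuous_linProjSym_param (Y := ℝ) (U := fun s j => U j s) (c := fun s j => c j s)
    (fun j m => h.contU j m) hc (fun s j => hA j s) (fun s j => hcd j s) l k

/-- The Duhamel integrand `s ↦ e^{-νₖ(τ-s)} (P linSym)(U(s), c(s))(l, k)` is continuous. [folklore] -/
theorem PicardHyp.continuous_integrand (h : PicardHyp ν T U a) {c : d → ℝ → (d → ℤ) → ℂ}
    {X : ℝ} (hc : ∀ l m, Continuous fun t => c l t m) (hcd : ∀ l t, HasDecay (latOrder d + 1) X (c l t))
    (l : d) (k : d → ℤ) (τ : ℝ) :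
    Continuous fun s => (heatFactor ν k (τ - s) : ℂ) *
      linProjSym (fun j => U j s) (fun j => c j s) l k :=
  (continuous_heatFactor_comp (continuous_const.sub continuous_id) ν k).mul
    (h.continuous_linProjSym hc hcd l k)

/-- **Continuity of the Duhamel map in time**: `t ↦ Φ(c)(l, t, k)` is continuous when `c` is
continuous in time with uniform decay of order `2#d + 1` (parametric interval integrals,
Mathlib `intervalIntegral.continuous_parametric_intervalIntegral_of_continuous`). [folklore] -/
theorem PicardHyp.continuous_picardMap (h : PicardHyp ν T U a) {c : d → ℝ → (d → ℤ) → ℂ}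
    {X : ℝ} (hc : ∀ l m, Continuous fun t => c l t m) (hcd : ∀ l t, HasDecay (latOrder d + 1) X (c l t))
    (l : d) (k : d → ℤ) : Continuous fun t => picardMap ν T U a c l t k := by
  have h1 : Continuous fun t => (heatFactor ν k (clamp T t) : ℂ) * a l k :=
    (continuous_heatFactor_comp (FourierNS.continuous_clamp T) ν k).mul continuous_const
  have hF : Continuous (Function.uncurry fun (t s : ℝ) => (heatFactor ν k (clamp T t - s) : ℂ) *
      linProjSym (fun j => U j s) (fun j => c j s) l k) := by
    have hcl : Continuous fun p : ℝ × ℝ => clamp T p.1 - p.2 :=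
      ((FourierNS.continuous_clamp T).comp continuous_fst).sub continuous_snd
    exact (continuous_heatFactor_comp hcl ν k).mul ((h.continuous_linProjSym hc hcd l k).comp continuous_snd)
  have h2 := intervalIntegral.continuous_parametric_intervalIntegral_of_continuous (μ := volume)
    (a₀ := 0) hF (FourierNS.continuous_clamp T)
  exact h1.sub h2

/-- **The first iterate** `c₁ = Φ(0)` is the free evolution of the datum:
`c₁(l, t, k) = e^{-νₖ clamp t} a(l, k)`. [folklore] -/
theorem picardMap_zero_field (ν T : ℝ) (U : d → ℝ → (d → ℤ) → ℂ) (a : d → (d → ℤ) → ℂ) (l : d)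
    (t : ℝ) (k : d → ℤ) :
    picardMap ν T U a (fun _ _ _ => 0) l t k = (heatFactor ν k (clamp T t) : ℂ) * a l k := by
  simp [picardMap]

/-- The first iterate decays to order `K` with the order-`K` constant of the datum (the heat
factor is at most one). [folklore] -/
theorem PicardHyp.hasDecay_picardMap_zero (h : PicardHyp ν T U a) {K : ℕ} {A₀ : ℝ}
    (ha : ∀ l, HasDecay K A₀ (a l)) (l : d) (t : ℝ) :
    HasDecay K A₀ (picardMap ν T U a (fun _ _ _ => 0) l t) := by
  intro k
  have hτ := FourierNS.clamp_mem_Icc h.hT.le t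
  rw [picardMap_zero_field, norm_mul, norm_heatFactor]
  calc heatFactor ν k (clamp T t) * ‖a l k‖ ≤ 1 * ‖a l k‖ :=
        mul_le_mul_of_nonneg_right (heatFactor_le_one h.hν.le k hτ.1) (norm_nonneg _)
    _ ≤ A₀ * ((1 + ‖k‖) ^ K)⁻¹ := by rw [one_mul]; exact ha l k

omit [DecidableEq d] in
/-- The first iterate is continuous in time at each component and frequency. [folklore] -/
theorem continuous_picardMap_zero [DecidableEq d] (ν T : ℝ) (U : d → ℝ → (d → ℤ) → ℂ)
    (a : d → (d → ℤ) → ℂ) (l : d) (k : d → ℤ) :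
    Continuous fun t => picardMap ν T U a (fun _ _ _ => 0) l t k := by
  simp only [picardMap_zero_field]
  exact (continuous_heatFactor_comp (FourierNS.continuous_clamp T) ν k).mul continuous_const

end Duhamel

/-! ### The contraction estimate in weighted sup-norms -/

section Contraction

omit [DecidableEq d] in
/-- The symbol constant of order `K`, `2#d · #d 2ᴷ latMass 2π·2(A + A₀)`, is nonnegative. [folklore] -/
theorem linConst_nonneg (K : ℕ) {A₀ A : ℝ} (hA₀ : 0 ≤ A₀) (hA : 0 ≤ A) :
    0 ≤ 2 * Fintype.card d * (Fintype.card d * (2 ^ K * latMass d * (2 * π * (2 * (A + A₀))))) := by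
  have := latMass_nonneg (d := d)
  positivity

/-- **Lipschitz estimate of the Duhamel map in the weighted sup-norm.** Let the drift
coefficients decay to orders `2#d + 1` (constant `A₀`) and `K + 1` (constant `A`), `K ≥ 2#d`,
and let `c₁`, `c₂` be continuous in time with uniform decay of order `2#d + 1`. If
`‖c₁(l,t,m) - c₂(l,t,m)‖ ≤ D e^{λ clamp t} (1+‖m‖)^{-(K+1)}` for all `l`, `t`, `m` (`λ ≥ 1`),
then `‖Φ(c₁)(l,t,k) - Φ(c₂)(l,t,k)‖ ≤ C_K · E(ν)/√λ · D e^{λ clamp t} (1+‖k‖)^{-(K+1)}` with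
`C_K = 2#d · #d 2ᴷ latMass 2π·2(A + A₀)` and `E(ν) = 1 + 1/(2√(4π²ν))`: the map is affine in
`c`, the projected symbol loses one order (`hasDecay_linSym`, `hasDecay_linProjSym`) and the
heat factor regains it at the price `λ^{-1/2}` (`ScalarFourier.heat_weight_gain`) — the
Fourier-side form of parabolic smoothing (Lemarié-Rieusset 2016, §8.5). [folklore] -/
theorem PicardHyp.hasDecay_picardMap_sub (h : PicardHyp ν T U a) {K : ℕ} (hK : latOrder d ≤ K)
    {A₀ A : ℝ} (hA₀ : 0 ≤ A₀) (hA : 0 ≤ A) (hU₀ : ∀ j t, HasDecay (latOrder d + 1) A₀ (U j t))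
    (hUK : ∀ j t, HasDecay (K + 1) A (U j t)) {c₁ c₂ : d → ℝ → (d → ℤ) → ℂ}
    (hc₁ : ∀ l m, Continuous fun t => c₁ l t m) (hc₂ : ∀ l m, Continuous fun t => c₂ l t m)
    {X₁ X₂ : ℝ} (hd₁ : ∀ l t, HasDecay (latOrder d + 1) X₁ (c₁ l t))
    (hd₂ : ∀ l t, HasDecay (latOrder d + 1) X₂ (c₂ l t)) {lam D : ℝ} (hlam : 1 ≤ lam) (hD : 0 ≤ D)
    (hdiff : ∀ l t, HasDecay (K + 1) (D * Real.exp (lam * clamp T t)) (fun m => c₁ l t m - c₂ l t m))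
    (l : d) (t : ℝ) :
    HasDecay (K + 1) (2 * Fintype.card d * (Fintype.card d * (2 ^ K * latMass d * (2 * π * (2 * (A + A₀))))) *
        ((1 + 1 / (2 * Real.sqrt (4 * π ^ 2 * ν))) / Real.sqrt lam) * D *
          Real.exp (lam * clamp T t))
      (fun k => picardMap ν T U a c₁ l t k - picardMap ν T U a c₂ l t k) := by
  intro k
  have hτ := FourierNS.clamp_mem_Icc h.hT.le t
  set τ := clamp T t with hτdef
  -- the two projected symbols and integrands
  set N₁ : ℝ → ℂ := fun s => linProjSym (fun j => U j s) (fun j => c₁ j s) l k with hN₁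
  set N₂ : ℝ → ℂ := fun s => linProjSym (fun j => U j s) (fun j => c₂ j s) l k with hN₂
  set F₁ : ℝ → ℂ := fun s => (heatFactor ν k (τ - s) : ℂ) * N₁ s with hF₁
  set F₂ : ℝ → ℂ := fun s => (heatFactor ν k (τ - s) : ℂ) * N₂ s with hF₂
  have hF₁c : Continuous F₁ := h.continuous_integrand hc₁ hd₁ l k τ
  have hF₂c : Continuous F₂ := h.continuous_integrand hc₂ hd₂ l k τ
  -- the difference of the two Duhamel maps
  have hdiffeq : picardMap ν T U a c₁ l t k - picardMap ν T U a c₂ l t k =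
      ∫ s in (0:ℝ)..τ, (heatFactor ν k (τ - s) : ℂ) * (N₂ s - N₁ s) := by
    change (heatFactor ν k τ : ℂ) * a l k - (∫ s in (0:ℝ)..τ, F₁ s) -
      ((heatFactor ν k τ : ℂ) * a l k - ∫ s in (0:ℝ)..τ, F₂ s) = _
    rw [sub_sub_sub_cancel_left, ← intervalIntegral.integral_sub (hF₂c.intervalIntegrable _ _)
      (hF₁c.intervalIntegrable _ _)]
    refine intervalIntegral.integral_congr fun s _ => ?_
    simp only [hF₁, hF₂]
    ring
  -- the difference of the symbols is the symbol of the difference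
  set C := 2 * Fintype.card d * (Fintype.card d * (2 ^ K * latMass d * (2 * π * (2 * (A + A₀))))) with hC
  have hC0 : 0 ≤ C := linConst_nonneg K hA₀ hA
  have hNbound : ∀ s ∈ Icc 0 τ, ‖N₂ s - N₁ s‖ ≤
      C * D * ((1 + ‖k‖) ^ K)⁻¹ * Real.exp (lam * s) := by
    intro s hs
    have hsT : s ∈ Icc 0 T := ⟨hs.1, hs.2.trans hτ.2⟩
    have hδ : ∀ j, HasDecay (K + 1) (D * Real.exp (lam * s)) (fun m => c₂ j s m - c₁ j s m) := by
      intro j m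
      have h1 := (hdiff j s) m
      rw [FourierNS.clamp_of_mem hsT] at h1
      rwa [norm_sub_rev] at h1
    have hδ₀ : ∀ j, HasDecay (latOrder d + 1) (D * Real.exp (lam * s)) (fun m => c₂ j s m - c₁ j s m) :=
      fun j => (hδ j).of_le (by omega)
    have hDs : 0 ≤ D * Real.exp (lam * s) := by positivity
    have hN := hasDecay_linSym (K := K) hA hDs (fun j => hU₀ j s) (fun j => hUK j s) hδ₀ hδ
    have hP := hasDecay_linProjSym hN l k
    have hsub := linProjSym_sub (fun j => hU₀ j s) (fun j => hd₂ j s) (fun j => hd₁ j s) l k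
    calc ‖N₂ s - N₁ s‖ = ‖linProjSym (fun j => U j s) (fun j m => c₂ j s m - c₁ j s m) l k‖ := by
          rw [hN₂, hN₁, hsub]
      _ ≤ _ := hP
      _ = C * D * ((1 + ‖k‖) ^ K)⁻¹ * Real.exp (lam * s) := by simp only [hC]; ring
  -- Duhamel bound and heat gain
  have hI := norm_duhamel_le ν hτ.1 (F := fun s => N₂ s - N₁ s)
    (M := C * D * ((1 + ‖k‖) ^ K)⁻¹) (lam := lam) hNbound k
  have hgain := heat_weight_gain h.hν hlam k hτ.1
  have hw : ((1 + ‖k‖) ^ K)⁻¹ = (1 + ‖k‖) * ((1 + ‖k‖) ^ (K + 1))⁻¹ := by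
    have : (0:ℝ) < 1 + ‖k‖ := by positivity
    rw [pow_succ]
    field_simp
  change ‖picardMap ν T U a c₁ l t k - picardMap ν T U a c₂ l t k‖ ≤ _
  rw [hdiffeq]
  calc ‖∫ s in (0:ℝ)..τ, (heatFactor ν k (τ - s) : ℂ) * (N₂ s - N₁ s)‖
      ≤ C * D * ((1 + ‖k‖) ^ K)⁻¹ *
          ∫ s in (0:ℝ)..τ, Real.exp (-(heatRate ν k) * (τ - s)) * Real.exp (lam * s) := hI
    _ = C * D * ((1 + ‖k‖) ^ (K + 1))⁻¹ * ((1 + ‖k‖) *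
          ∫ s in (0:ℝ)..τ, Real.exp (-(heatRate ν k) * (τ - s)) * Real.exp (lam * s)) := by
        rw [hw]; ring
    _ ≤ C * D * ((1 + ‖k‖) ^ (K + 1))⁻¹ *
          (Real.exp (lam * τ) * ((1 + 1 / (2 * Real.sqrt (4 * π ^ 2 * ν))) / Real.sqrt lam)) :=
        mul_le_mul_of_nonneg_left hgain (by positivity)
    _ = C * ((1 + 1 / (2 * Real.sqrt (4 * π ^ 2 * ν))) / Real.sqrt lam) * D *
          Real.exp (lam * τ) * ((1 + ‖k‖) ^ (K + 1))⁻¹ := by ring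

/-- **Choice of the time weight.** For every order `K ≥ 2#d` there is `λ ≥ 1` such that the
Duhamel map contracts weighted differences of order `K + 1` by the factor `1/2`:
if `‖c₁(l,t) - c₂(l,t)‖ ≤ D e^{λ clamp t}(1+‖·‖)^{-(K+1)}` then
`‖Φc₁(l,t) - Φc₂(l,t)‖ ≤ ½ D e^{λ clamp t}(1+‖·‖)^{-(K+1)}` (take `λ = (2 C_K E(ν))² + 1` in
`hasDecay_picardMap_sub`). The interval is NOT shrunk: the equation is linear. [folklore] -/
theorem PicardHyp.exists_contraction (h : PicardHyp ν T U a) {K : ℕ} (hK : latOrder d ≤ K) :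
    ∃ lam : ℝ, 1 ≤ lam ∧ ∀ (c₁ c₂ : d → ℝ → (d → ℤ) → ℂ) (X₁ X₂ D : ℝ),
      (∀ l m, Continuous fun t => c₁ l t m) → (∀ l m, Continuous fun t => c₂ l t m) →
      (∀ l t, HasDecay (latOrder d + 1) X₁ (c₁ l t)) → (∀ l t, HasDecay (latOrder d + 1) X₂ (c₂ l t)) →
      0 ≤ D →
      (∀ l t, HasDecay (K + 1) (D * Real.exp (lam * clamp T t)) (fun m => c₁ l t m - c₂ l t m)) →
      ∀ l t, HasDecay (K + 1) (1 / 2 * D * Real.exp (lam * clamp T t))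
        (fun k => picardMap ν T U a c₁ l t k - picardMap ν T U a c₂ l t k) := by
  obtain ⟨A₀, hA₀, hU₀⟩ := h.decayU_nonneg (latOrder d + 1)
  obtain ⟨A, hA, hUK⟩ := h.decayU_nonneg (K + 1)
  set L := 2 * Fintype.card d * (Fintype.card d * (2 ^ K * latMass d * (2 * π * (2 * (A + A₀))))) *
    (1 + 1 / (2 * Real.sqrt (4 * π ^ 2 * ν))) with hL
  have hL0 : 0 ≤ L := by
    have := linConst_nonneg (d := d) K hA₀ hA
    positivity
  refine ⟨(2 * L) ^ 2 + 1, by nlinarith, ?_⟩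
  intro c₁ c₂ X₁ X₂ D hc₁ hc₂ hd₁ hd₂ hD hdiff l t
  have hlam : (1 : ℝ) ≤ (2 * L) ^ 2 + 1 := by nlinarith
  have key := h.hasDecay_picardMap_sub hK hA₀ hA hU₀ hUK hc₁ hc₂ hd₁ hd₂ hlam hD hdiff l t
  refine key.mono ?_
  have hsq : 2 * L ≤ Real.sqrt ((2 * L) ^ 2 + 1) := by
    calc 2 * L = Real.sqrt ((2 * L) ^ 2) := (Real.sqrt_sq (by positivity)).symm
      _ ≤ Real.sqrt ((2 * L) ^ 2 + 1) := Real.sqrt_le_sqrt (by linarith)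
  have hspos : 0 < Real.sqrt ((2 * L) ^ 2 + 1) := Real.sqrt_pos.2 (by positivity)
  have hfac : 2 * Fintype.card d * (Fintype.card d * (2 ^ K * latMass d * (2 * π * (2 * (A + A₀))))) *
      ((1 + 1 / (2 * Real.sqrt (4 * π ^ 2 * ν))) / Real.sqrt ((2 * L) ^ 2 + 1)) ≤ 1 / 2 := by
    rw [mul_div_assoc', ← hL, div_le_iff₀ hspos]
    linarith
  have hE : 0 ≤ D * Real.exp (((2 * L) ^ 2 + 1) * clamp T t) := by positivity
  calc _ = 2 * Fintype.card d * (Fintype.card d * (2 ^ K * latMass d * (2 * π * (2 * (A + A₀))))) *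
        ((1 + 1 / (2 * Real.sqrt (4 * π ^ 2 * ν))) / Real.sqrt ((2 * L) ^ 2 + 1)) *
        (D * Real.exp (((2 * L) ^ 2 + 1) * clamp T t)) := by ring
    _ ≤ 1 / 2 * (D * Real.exp (((2 * L) ^ 2 + 1) * clamp T t)) :=
        mul_le_mul_of_nonneg_right hfac hE
    _ = _ := by ring

end Contraction

end LinearisedNSFourier

end Literature.Analysis.FluidPDE

end
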